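/-
Copyright (c) 2026 the pub-hodgecm-mathlib formalisation cell (harness21).  Prover seat hodgecm-mathlib-LH4-p19 (g2), req620 Track A «(D-RAM) FOUR-FRAME» squad
(STAGE-1b, row (2) of the piece `f_{T₊}`, the (β₂) road (R-36) «PURE-CELL LEDGER»; β₂ sub-dealer LH4-p04 lineage, lane B (RamK), row (L-D♭) «the diagonal cell below the
clean line» — the COUNT, E-side reading of the label), 2026-09-04.
-/
import Summits.HodgeConjecture.HodgeConjecture.Theorems.F0P3cDyRamDiagonalCellCleanRegime   -- ★ p861813 (LH4-p19 (g0)): `refSkew_map_and_v` (`σt₊ = −t₊`, `|t₊| = 1` at `d` even), `v_varpi_pow_le_pow`; brings ★ `exists_fixed_coords_of_map_ne`, `v_fixed_add_fixed_mul_eq_max`, `mstarOfRecord`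
import Literature.NumberTheory.LocalFields.WildQuadraticDatumNormSignConductor            -- ★ (LH4-p06 (g3)): `normSign_eq_of_near`, `normSign_mul_of_fixed`; brings ★ `normSign`
import HarnessLib

/-!
# Crux `H413`, line LH4 «(D-RAM) FOUR-FRAME» — STAGE-1b, row (2), the (β₂) road (R-36), lane B, row (L-D♭), THE COUNT — «THE LABEL OF A D-VERTEX IS AN AFFINE SIGN
# `ω(T̂)·ω(α₁ + γ₁V)`»: if the letter scalar factors as `s = T̂·(â + b̂·V)` (`T̂, V ∈ F`, `|â| = 1`, `|b̂| = |ϖ|^{2g}`), then EVERY `σ`-fixed `f` with `|s − f·t₊| ≤ |ϖ|^{m*}` has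
# `ω(f) = ω(T̂)·ω(α₁ + γ₁V)` with `α₁, γ₁ ∈ F` the Eisenstein leading coefficients of `â∕t₊, b̂∕t₊` — INDEPENDENT OF THE VERTEX (`|α₁| = 1`, `|γ₁| = |ϖ|^{2g}`)

Cell `hodgecm-mathlib` (D-0151), FLOOR 0, crux item H413 = `stmt-HodgeConjecture-24833`, route of record `HCCMUnconditional`; squad F0∕P3c∕LH4; lane
`--supports stmt-HodgeConjecture-24833 --as helper` (count-neutral; pays NO tier-0 row).  THEOREMS ONLY (no `def`, no instance, no notation, no `sorry`, default heartbeats);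
★-only imports; states NO law; (β₂) stays a HYPOTHESIS.  DATUM-FREE E-side algebra: one valued field `K` with the sheet datum `IsRamifiedQuadraticDatum σ ϖ d t`, `d` even; no
lattice, no line model.

WHY (this seat's ★ p862554 ∕ p862573: the letter of a D-vertex is `VS_{m*}(f_Λ • X₊)` for any `σ`-fixed unit `f_Λ` with `|s_Λ − f_Λ·t₊| ≤ |ϖ|^{m*}`, `jE s_Λ = Tr_ρ(μ∕D₀)`; ★-cand
K3 `F0P3cDyRamDiagonalCellCoordinates`: `Tr_ρ(μ∕D₀) = Â·T + B̂·W`, i.e. `s_Λ = T̂·(â + b̂·V)` with `T̂ = jE⁻¹Tr_ρ ŵ ∈ 𝒪_Fˣ`, `V = Ŵ∕T̂ ∈ 𝒪_F` the coordinates of the vertex and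
`â, b̂` the `ρ`-coordinates of `μ∕P`, `|â| = 1`, `|b̂| = |ϖ|^{2g}`; ★ p861154: label `+` ⟺ `f_Λ ∈ N(E^×)` ⟺ `ω(f_Λ) = 1`).  THIS FILE turns the label into the AFFINE SIGN the digit
count ★ p862655 consumes: `ω(f_Λ) = ω(T̂)·ω(α₁ + γ₁V)` — so on the POPULATED part (`ω(T̂) = ω(−h_W)` constant, ★-cand K3 `glueUnit_mul_eq_neg_trace`) the label is `ω(α₁ + γ₁V)`
up to a constant sign.  Mechanism: Eisenstein coordinates `â∕t₊ = α₁ + y₁ϖ`, `b̂∕t₊ = γ₁ + y₂ϖ` (★ `exists_fixed_coords_of_map_ne`), so `s∕t₊ = f₀ + Y·ϖ` with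
`f₀ = T̂(α₁ + γ₁V)`, `Y = T̂(y₁ + y₂V)` fixed; `|s∕t₊ − f| ≤ |ϖ|^{m*}` and ★ `v_fixed_add_fixed_mul_eq_max` force `|f₀ − f| ≤ |ϖ|^{m*} = |ϖ|^{2d−1}`, inside the conductor
(★ `normSign_eq_of_near`), and `ω` is multiplicative on fixed units (★ `normSign_mul_of_fixed`).
* §1 `v_fst_eq_of_fixed_coords` — the leading Eisenstein coefficient of an element of EVEN valuation has the same valuation (parity of fixed elements).
* §2 HEAD `exists_affineLabel_of_coords` — `∃ α₁ γ₁ ∈ F`, `|α₁| = 1`, `|γ₁| = |ϖ|^{2g}`, such that for ALL fixed `T̂` (unit), `V` (integral) and fixed `f` with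
  `|T̂(â + b̂V) − f·t₊| ≤ |ϖ|^{m*}`: `ω(f) = ω(T̂)·ω(α₁ + γ₁V)`.
WHAT IS NOT CLAIMED: the factorisation `s_Λ = T̂(â + b̂V)` itself (K3, M-side), the digit counts (★ p862655 ∕ K2), the lattice fibration and assembly (K5–K6).
HONEST LABEL.  Count-neutral local algebra; nothing printed is asserted; no census law is stated; `HC_CM` is proved only modulo the 7 printed citations (2 remaining named inputs:
hLiu418 = `stmt-HodgeConjecture-24832`, h413 = `stmt-HodgeConjecture-24833`) until rung 0 closes.
## References
* [Serre1979] J.-P. Serre, *Local Fields*, GTM 67 (1979): Ch. I §6 Prop. 18 (`𝒪_E = 𝒪_F[ϖ]`), Ch. V §3 Prop. 5, Cor. 3 pp. 85–87 (conductor), Ch. XV §2.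
* [Rogawski1990] J. D. Rogawski, *Automorphic Representations of Unitary Groups in Three Variables*, Ann. of Math. Stud. 123 (1990): §4.9 Prop. 4.9.1 (b) p. 55, §12.2.
* [LanglandsShelstad1987] R. P. Langlands, D. Shelstad, *On the definition of transfer factors*, Math. Ann. 278 (1987): §1–§3 (κ-signs).
* [Kottwitz1986BaseChangeUnits] R. E. Kottwitz, *Base change for unit elements of Hecke algebras*, Compositio Math. 60 (1986): §1 pp. 240–241.
-/

set_option autoImplicit false

noncomputable section

namespace Summit.HodgeConjecture.HodgeConjecture.Cruxes.H413.F0P3cDyRamDiagonalCellAffineLabel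

open scoped Valued WithZero
open WithZero
open Literature.NumberTheory.Automorphic.UnitaryThreeFourFrame (IsRamifiedQuadraticDatum normSign)
open Literature.NumberTheory.LocalFields (exists_fixed_coords_of_map_ne v_fixed_add_fixed_mul_eq_max)
open Literature.NumberTheory.LocalFields.WildQuadraticDatum (v_varpi_pow even_log_v_of_fixed normSign_eq_of_near normSign_mul_of_fixed)
open Summit.HodgeConjecture.HodgeConjecture.Cruxes.H413.F0P3cDyRamFourFramePieces (mstarOfRecord)
open Summit.HodgeConjecture.HodgeConjecture.Cruxes.H413.F0P3cDyRamDiagonalCellCleanRegime (refSkew_map_and_v v_varpi_pow_le_pow)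

variable {K : Type} [Field K] [Valued K ℤᵐ⁰] {σ : K →+* K} {ϖ : K} {d t : ℕ}

/-! ## §1 The leading Eisenstein coefficient of an element of even valuation -/

/-- **THE LEADING COEFFICIENT CARRIES THE (EVEN) VALUATION**: at a sheet datum, for `σ`-fixed `a, b` with `|a + b·ϖ| = exp(2n)` one has `|a| = exp(2n)` (★ `v_fixed_add_fixed_mul_eq_max`:
the value is `max(|a|, |b|·exp(−1))` and `|b|·exp(−1)` has odd exponent). [cite: Serre1979, Ch. I §6 Prop. 18] -/
theorem v_fst_eq_of_fixed_coords (hD : IsRamifiedQuadraticDatum σ ϖ d t) {a b : K} (ha : σ a = a) (hb : σ b = b) {n : ℤ}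
    (hab : Valued.v (a + b * ϖ) = exp (2 * n)) : Valued.v a = exp (2 * n) := by
  obtain ⟨hσσ, hvσ, hϖ, hfix, hdd, hd1, ht⟩ := hD
  have hfix' : ∀ c : K, σ c = c → c ≠ 0 → Even (log (Valued.v c)) := fun c hc hc0 => even_log_v_of_fixed hfix c hc hc0
  have hmax := v_fixed_add_fixed_mul_eq_max hfix' hϖ ha hb
  rw [hab] at hmax
  rcases le_total (Valued.v b * exp (-1 : ℤ)) (Valued.v a) with h | h
  · rw [max_eq_left h] at hmax; exact hmax.symm
  · rw [max_eq_right h] at hmax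
    -- `exp(2n) = |b|·exp(−1)` contradicts parity
    exfalso
    have hb0 : b ≠ 0 := by
      intro h0; rw [h0, map_zero, zero_mul] at hmax; exact exp_ne_zero hmax
    obtain ⟨k, hk⟩ := hfix b hb hb0
    rw [hk, ← exp_add] at hmax
    have := exp_injective hmax
    omega

/-! ## §2 HEAD — the label is the affine sign `ω(T̂)·ω(α₁ + γ₁V)` -/

/-- **HEAD — «THE LABEL OF A D-VERTEX IS AN AFFINE SIGN».**  At a complete sheet datum `IsRamifiedQuadraticDatum σ ϖ d t` with finite residue field and `d` EVEN, for `â, b̂` with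
`|â| = 1`, `|b̂| = |ϖ|^{2g}`, `1 ≤ g`, there are `σ`-FIXED `α₁, γ₁` with `|α₁| = 1`, `|γ₁| = |ϖ|^{2g}` (the leading Eisenstein coefficients of `â∕t₊`, `b̂∕t₊`,
`t₊ = (ϖ − σϖ)((ϖσϖ)^{d∕2})⁻¹`) such that: for every `σ`-fixed unit `T̂`, `σ`-fixed integer `V` and `σ`-fixed `f` with `|T̂·(â + b̂·V) − f·t₊| ≤ |ϖ|^{m*}` (`m* = mstarOfRecord d`),
`ω(f) = ω(T̂)·ω(α₁ + γ₁V)`.  (With ★-cand K3: `s_Λ = T̂(â + b̂V)`; with ★ p862554 + ★ p861154: label(Λ) = `ω(f_Λ)`; so on the populated part of `D` the label is the affine sign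
`ω(α₁ + γ₁V)` of ★ p862655's digit count, up to the constant `ω(T̂) = ω(−h_W)`.) [cite: Serre1979, Ch. I §6 Prop. 18] [cite: Serre1979, Ch. V §3 Cor. 3 pp. 85–87]
[cite: Rogawski1990, §4.9 Prop. 4.9.1 (b) p. 55] [cite: LanglandsShelstad1987, §1–§3] -/
theorem exists_affineLabel_of_coords [CompleteSpace K] [Finite 𝓀[K]] (hD : IsRamifiedQuadraticDatum σ ϖ d t) (hd2 : d % 2 = 0)
    {â bh : K} (hâ : Valued.v â = 1) {g : ℕ} (hbh : Valued.v bh = Valued.v ϖ ^ (2 * g)) (hg1 : 1 ≤ g) :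
    ∃ α₁ γ₁ : K, σ α₁ = α₁ ∧ Valued.v α₁ = 1 ∧ σ γ₁ = γ₁ ∧ Valued.v γ₁ = Valued.v ϖ ^ (2 * g) ∧
      ∀ (T V f : K), σ T = T → Valued.v T = 1 → σ V = V → Valued.v V ≤ 1 → σ f = f →
        Valued.v (T * (â + bh * V) - f * ((ϖ - σ ϖ) * ((ϖ * σ ϖ) ^ ((d - d % 2) / 2))⁻¹)) ≤ Valued.v ϖ ^ mstarOfRecord d →
        normSign σ f = normSign σ T * normSign σ (α₁ + γ₁ * V) := by
  obtain ⟨hσt, hvt⟩ := refSkew_map_and_v hD hd2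
  obtain ⟨hσσ, hvσ, hϖ, hfix, hdd, hd1, ht⟩ := hD
  have hfix' : ∀ c : K, σ c = c → c ≠ 0 → Even (log (Valued.v c)) := fun c hc hc0 => even_log_v_of_fixed hfix c hc hc0
  have hvϖ0 : Valued.v ϖ ≠ 0 := by rw [hϖ]; exact exp_ne_zero
  have hϖlt : Valued.v ϖ < 1 := by rw [hϖ, ← exp_zero, exp_lt_exp]; norm_num
  have hϖσ : σ ϖ ≠ ϖ := fun h => by
    have : Valued.v (ϖ - σ ϖ) = 0 := by rw [h, sub_self, map_zero]
    rw [hdd] at this; exact pow_ne_zero _ hvϖ0 this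
  set tp : K := (ϖ - σ ϖ) * ((ϖ * σ ϖ) ^ ((d - d % 2) / 2))⁻¹ with htp
  have htp0 : tp ≠ 0 := fun h0 => by rw [h0, map_zero] at hvt; exact zero_ne_one hvt
  -- Eisenstein coordinates of `â/t₊` and `b̂/t₊`
  obtain ⟨α₁, y₁, hα₁, hy₁, hα⟩ := exists_fixed_coords_of_map_ne hσσ hϖσ (â / tp)
  obtain ⟨γ₁, y₂, hγ₁, hy₂, hγ⟩ := exists_fixed_coords_of_map_ne hσσ hϖσ (bh / tp)
  have hα1 : Valued.v α₁ = 1 := by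
    have h := v_fst_eq_of_fixed_coords ⟨hσσ, hvσ, hϖ, hfix, hdd, hd1, ht⟩ hα₁ hy₁ (n := 0) (by rw [← hα, map_div₀, hâ, hvt, div_one]; norm_num)
    rw [h]; norm_num
  have hγ1 : Valued.v γ₁ = Valued.v ϖ ^ (2 * g) := by
    have h := v_fst_eq_of_fixed_coords ⟨hσσ, hvσ, hϖ, hfix, hdd, hd1, ht⟩ hγ₁ hy₂ (n := -(g : ℤ))
      (by rw [← hγ, map_div₀, hbh, hvt, div_one, v_varpi_pow hϖ]; push_cast; ring_nf)
    rw [h, v_varpi_pow hϖ]; push_cast; ring_nf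
  refine ⟨α₁, γ₁, hα₁, hα1, hγ₁, hγ1, fun T V f hσT hT1 hσV hV1 hσf hsf => ?_⟩
  have hT0 : T ≠ 0 := fun h0 => by rw [h0, map_zero] at hT1; exact zero_ne_one hT1
  -- the affine part `f₀` and the tail `Y`
  set f₀ : K := T * (α₁ + γ₁ * V) with hf₀
  set Y : K := T * (y₁ + y₂ * V) with hY
  have hσf₀ : σ f₀ = f₀ := by rw [hf₀, map_mul, map_add, map_mul, hσT, hα₁, hγ₁, hσV]
  have hσY : σ Y = Y := by rw [hY, map_mul, map_add, map_mul, hσT, hy₁, hy₂, hσV]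
  have hdec : T * (â + bh * V) / tp = f₀ + Y * ϖ := by
    have e1 : â = (α₁ + y₁ * ϖ) * tp := by rw [← hα, div_mul_cancel₀ â htp0]
    have e2 : bh = (γ₁ + y₂ * ϖ) * tp := by rw [← hγ, div_mul_cancel₀ bh htp0]
    rw [e1, e2, hf₀, hY]; field_simp; ring
  -- `|f₀| = 1`
  have hγlt : Valued.v (γ₁ * V) < Valued.v α₁ := by
    rw [hα1, Valuation.map_mul, hγ1]
    calc Valued.v ϖ ^ (2 * g) * Valued.v V ≤ Valued.v ϖ ^ (2 * g) * 1 := by gcongr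
      _ < 1 := by rw [mul_one]; exact pow_lt_one₀ zero_le hϖlt (by omega)
  have hf₀1 : Valued.v f₀ = 1 := by rw [hf₀, Valuation.map_mul, hT1, one_mul, Valuation.map_add_eq_of_lt_left _ hγlt, hα1]
  -- `|f₀ − f| ≤ |ϖ|^{m*}`
  have hnear : Valued.v (f₀ - f) ≤ Valued.v ϖ ^ mstarOfRecord d := by
    have h1 : Valued.v (T * (â + bh * V) / tp - f) ≤ Valued.v ϖ ^ mstarOfRecord d := by
      have e : T * (â + bh * V) / tp - f = (T * (â + bh * V) - f * tp) / tp := by field_simp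
      rw [e, map_div₀, hvt, div_one]; exact hsf
    rw [hdec] at h1
    have e2 : f₀ + Y * ϖ - f = (f₀ - f) + Y * ϖ := by ring
    rw [e2, v_fixed_add_fixed_mul_eq_max hfix' hϖ (by rw [map_sub, hσf₀, hσf]) hσY] at h1
    exact (le_max_left _ _).trans h1
  have hD' : IsRamifiedQuadraticDatum σ ϖ d t := ⟨hσσ, hvσ, hϖ, hfix, hdd, hd1, ht⟩
  rw [normSign_eq_of_near hD' hσf₀ hσf hf₀1 (n := mstarOfRecord d) (by simp only [mstarOfRecord]; omega) hnear, hf₀]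
  have hαV0 : α₁ + γ₁ * V ≠ 0 := fun h0 => by
    have : Valued.v (α₁ + γ₁ * V) = 1 := by rw [Valuation.map_add_eq_of_lt_left _ hγlt, hα1]
    rw [h0, map_zero] at this; exact zero_ne_one this
  exact normSign_mul_of_fixed hD' hσT (by rw [map_add, map_mul, hα₁, hγ₁, hσV]) hT0 hαV0

end Summit.HodgeConjecture.HodgeConjecture.Cruxes.H413.F0P3cDyRamDiagonalCellAffineLabel

end
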